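import Summits.CriticalPhenomena.CardyFormulaZ2.Theses.CardyAnchoredRigidity
import Summits.CriticalPhenomena.CardyFormulaZ2.Theses.CardyMirrorMonotone
import Summits.CriticalPhenomena.CardyFormulaZ2.Theorems.CardyAnchoredRigiditySubseqCardyStubDiagonalCauchy
import Literature.Probability.Percolation.BoxCrossingJordan
import Literature.Probability.RandomPlanarGeometry.ConformalRectangleProofs
import Literature.Probability.RandomPlanarGeometry.CardyFunctionIncBeta
import Literature.Probability.RandomPlanarGeometry.CritPercSLELocalityProofs

/-!
# Crux `SubseqCardy` (stmt-CriticalPhenomena-5768), line `registered`: the reduction of the two open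
# stubs to existing items, and the precompactness of the bond-`ℤ²` crossing functions

Route `CardyAnchoredRigidity` (decl shared verbatim with `CardyLocalRigidity`), sub-problem
`CardyFormulaZ2`. The line proves the crux from four stubs: S1a `stub_diagonalCauchy` (landed,
`…StubDiagonalCauchy.lean`) + S1b `stub_countableApprox` (countable uniform approximability) give ONE
mesh sequence with a JOINT limit `g` of the crossing probabilities of every conformal rectangle; S2
`stub_limitConformal` says every such joint limit factors through the conformal modulus; S3
`stub_conformalLimitIsCardy` says a joint limit that factors through the modulus is Cardy's function.

This file records, sorry-free and over proved tree facts only: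

* `exists_strictMono_jointLimit_of_countableApprox` — **precompactness**: under S1b, EVERY mesh
  sequence `u → 0⁺` has a subsequence along which the crossing probabilities of every conformal
  rectangle converge jointly (Cantor diagonal over the countable family + the `ε/3` lemma
  `exists_tendsto_comp_of_forall_approx` of the S1a file);
* `stub_limitConformal_of_subseqConformalInvariance` and
  `subseqConformalInvariance_of_stub_limitConformal` — **S2 is, given S1b, EQUIVALENT to the open
  target `CardyMirrorMonotone.SubseqConformalInvariance`** (stmt-CriticalPhenomena-8266, "X_M":
  conformal invariance of bond-`ℤ²` crossing sublimits, Schramm's Problem 2.11 grade; verbatim twins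
  stmt-4678 `CardyExpCovariance.SubseqConformalInvariance`, `CardyBlackNoise.SubseqConformalInvariance`);
* `stub_conformalLimitIsCardy_of_subseqRigidity` and `subseqRigidity_of_stub_conformalLimitIsCardy` —
  **S3 is EQUIVALENT to the open crux `CardyMirrorMonotone.SubseqRigidity`** (stmt-CriticalPhenomena-8271;
  verbatim twins stmt-4680 `CardyExpCovariance.CardyRigiditySeq`, stmt-8850
  `CardyBlackNoise.SubseqCardyRigidity`);
* `subseqCardy_of_items` (registered sub-goal) — **the crux is closed modulo the two
  existing items 8266 and 8271** (ten lines: run X_M along `1/(n+1)`, identify the kernel by rigidity,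
  moduli of uniformizing data lie in `(0,1)`);
* `jointLimit_mem_Ioo` — every joint sequential limit is `(0,1)`-valued (RSW,
  `discreteCrossingProb_clusterPt_mem_Ioo_holds`), so none of the above is vacuous.

References: O. Schramm, Proc. ICM 2006, Problem 2.11; S. Smirnov, C. R. Acad. Sci. 333 (2001);
F. Camia, C. M. Newman, Probab. Theory Related Fields 139 (2007) §5–7; O. Schramm, S. Smirnov,
Ann. Probab. 39 (2011) §5.
-/

namespace Summit.CriticalPhenomena.CardyFormulaZ2.Cruxes.SubseqCardy.Birth

open Filter Topology Set
open Literature.Probability.RandomPlanarGeometry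
open Literature.Probability.Percolation hiding cardyFunction
open Summit.CriticalPhenomena.CardyFormulaZ2.Theses

/-! ### Precompactness: joint subsequential limits along every mesh sequence -/

/-- **Precompactness of the bond-`ℤ²` crossing functions, from countable uniform approximability.**
If a countable family `Rk` of conformal rectangles approximates the crossing probability of every
conformal rectangle within any `ε` for all small meshes (stub S1b), then EVERY sequence of meshes
`u n → 0⁺` has a subsequence `u ∘ φ` along which the crossing probabilities
`bondDomainCrossingProb R (u (φ n))` of every conformal rectangle `R` converge (Cantor diagonal over
the countable family, `Literature.Analysis.FunctionSpaces.exists_strictMono_forall_tendsto_real`,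
then the `ε/3` Cauchy argument `exists_tendsto_comp_of_forall_approx`). This is the existence half of
the target `SubseqConformalInvariance` (stmt-CriticalPhenomena-8266). [folklore] -/
theorem exists_strictMono_jointLimit_of_countableApprox
    (h : ∃ Rk : ℕ → Literature.Probability.RandomPlanarGeometry.ConformalRectangle,
      ∀ (R : Literature.Probability.RandomPlanarGeometry.ConformalRectangle) (ε : ℝ), 0 < ε →
        ∃ k : ℕ, ∀ᶠ δ in nhdsWithin (0 : ℝ) (Set.Ioi 0),
          |Literature.Probability.Percolation.bondDomainCrossingProb R δ -
            Literature.Probability.Percolation.bondDomainCrossingProb (Rk k) δ| ≤ ε)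
    (u : ℕ → ℝ) (hu : Tendsto u atTop (𝓝[>] (0 : ℝ))) :
    ∃ φ : ℕ → ℕ, StrictMono φ ∧
      ∃ g : Literature.Probability.RandomPlanarGeometry.ConformalRectangle → ℝ,
        ∀ R : Literature.Probability.RandomPlanarGeometry.ConformalRectangle,
          Tendsto (fun n => bondDomainCrossingProb R (u (φ n))) atTop (𝓝 (g R)) := by
  obtain ⟨Rk, hRk⟩ := h
  -- the countable family along `u` is bounded by `1`
  have hb : ∀ k : ℕ, ∃ C : ℝ, ∀ n : ℕ,
      |(fun (n k : ℕ) => bondDomainCrossingProb (Rk k) (u n)) n k| ≤ C := by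
    refine fun k => ⟨1, fun n => ?_⟩
    obtain ⟨h0, h1⟩ := bondDomainCrossingProb_mem_Icc (Rk k) (u n)
    exact abs_le.2 ⟨by linarith, h1⟩
  -- diagonal extraction: a common convergent subsequence `φ`
  obtain ⟨φ, hφ, hlim⟩ :=
    Literature.Analysis.FunctionSpaces.exists_strictMono_forall_tendsto_real
      (fun (n k : ℕ) => bondDomainCrossingProb (Rk k) (u n)) hb
  have huφ : Tendsto (u ∘ φ) atTop (𝓝[>] (0 : ℝ)) := hu.comp hφ.tendsto_atTop
  -- every rectangle's crossing probabilities are Cauchy along `u ∘ φ`, hence converge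
  have hall : ∀ R : ConformalRectangle, ∃ x : ℝ,
      Tendsto (fun n => bondDomainCrossingProb R ((u ∘ φ) n)) atTop (𝓝 x) := fun R =>
    exists_tendsto_comp_of_forall_approx huφ (a := fun δ => bondDomainCrossingProb R δ)
      (b := fun k δ => bondDomainCrossingProb (Rk k) δ) (hRk R) hlim
  choose g hg using hall
  exact ⟨φ, hφ, g, hg⟩

/-! ### S2 `stub_limitConformal` is the open target `SubseqConformalInvariance` (stmt-8266) -/

/-- **S2 from X_M.** The target `CardyMirrorMonotone.SubseqConformalInvariance`
(stmt-CriticalPhenomena-8266: every mesh sequence has a subsequence along which all crossing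
probabilities converge to ONE function of the modulus) implies the registered stub S2
`stub_limitConformal`: a joint limit `g` along `u` is also the limit along the subsequence X_M
provides, where the limit is `G (crossRatio x)`; limits are unique. [folklore] -/
theorem stub_limitConformal_of_subseqConformalInvariance
    (hXM : CardyMirrorMonotone.SubseqConformalInvariance) :
    ∀ u : ℕ → ℝ, Filter.Tendsto u Filter.atTop (nhdsWithin (0 : ℝ) (Set.Ioi 0)) →
      ∀ g : Literature.Probability.RandomPlanarGeometry.ConformalRectangle → ℝ,
        (∀ R : Literature.Probability.RandomPlanarGeometry.ConformalRectangle,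
          Filter.Tendsto (fun n => Literature.Probability.Percolation.bondDomainCrossingProb R (u n))
            Filter.atTop (nhds (g R))) →
        ∃ G : ℝ → ℝ,
          ∀ (R : Literature.Probability.RandomPlanarGeometry.ConformalRectangle)
            (φ : Literature.Probability.RandomPlanarGeometry.ConformalEquiv
              UpperHalfPlane.upperHalfPlaneSet R.carrier)
            (x : Fin 4 → ℝ), R.IsUniformizing φ x →
            g R = G (Literature.Probability.RandomPlanarGeometry.crossRatio x) := by
  intro u hu g hg
  obtain ⟨φ, hφ, G, hG⟩ := hXM u hu
  exact ⟨G, fun R ψ x hx => tendsto_nhds_unique ((hg R).comp hφ.tendsto_atTop) (hG R ψ x hx)⟩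

/-- **X_M from S2 and S1b.** Conversely, countable uniform approximability (stub S1b) and the
registered stub S2 `stub_limitConformal` imply the target `CardyMirrorMonotone.SubseqConformalInvariance`
(stmt-CriticalPhenomena-8266): extract a jointly convergent subsequence
(`exists_strictMono_jointLimit_of_countableApprox`) and factor its limit through the modulus by S2.
So, given S1b, S2 is EXACTLY the open target X_M. [folklore] -/
theorem subseqConformalInvariance_of_stub_limitConformal
    (h₁b : ∃ Rk : ℕ → Literature.Probability.RandomPlanarGeometry.ConformalRectangle,
      ∀ (R : Literature.Probability.RandomPlanarGeometry.ConformalRectangle) (ε : ℝ), 0 < ε →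
        ∃ k : ℕ, ∀ᶠ δ in nhdsWithin (0 : ℝ) (Set.Ioi 0),
          |Literature.Probability.Percolation.bondDomainCrossingProb R δ -
            Literature.Probability.Percolation.bondDomainCrossingProb (Rk k) δ| ≤ ε)
    (h₂ : ∀ u : ℕ → ℝ, Filter.Tendsto u Filter.atTop (nhdsWithin (0 : ℝ) (Set.Ioi 0)) →
      ∀ g : Literature.Probability.RandomPlanarGeometry.ConformalRectangle → ℝ,
        (∀ R : Literature.Probability.RandomPlanarGeometry.ConformalRectangle,
          Filter.Tendsto (fun n => Literature.Probability.Percolation.bondDomainCrossingProb R (u n))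
            Filter.atTop (nhds (g R))) →
        ∃ G : ℝ → ℝ,
          ∀ (R : Literature.Probability.RandomPlanarGeometry.ConformalRectangle)
            (φ : Literature.Probability.RandomPlanarGeometry.ConformalEquiv
              UpperHalfPlane.upperHalfPlaneSet R.carrier)
            (x : Fin 4 → ℝ), R.IsUniformizing φ x →
            g R = G (Literature.Probability.RandomPlanarGeometry.crossRatio x)) :
    CardyMirrorMonotone.SubseqConformalInvariance := by
  intro u hu
  obtain ⟨φ, hφ, g, hg⟩ := exists_strictMono_jointLimit_of_countableApprox h₁b u hu
  obtain ⟨G, hG⟩ := h₂ (u ∘ φ) (hu.comp hφ.tendsto_atTop) g hg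
  exact ⟨φ, hφ, G, fun R ψ x hx => hG R ψ x hx ▸ hg R⟩

/-! ### S3 `stub_conformalLimitIsCardy` is the open crux `SubseqRigidity` (stmt-8271) -/

/-- **S3 from sequential rigidity.** The crux `CardyMirrorMonotone.SubseqRigidity`
(stmt-CriticalPhenomena-8271: a modulus-kernel `G` of a jointly convergent mesh sequence is Cardy's
function on `(0,1)`) implies the registered stub S3 `stub_conformalLimitIsCardy`: the joint limit `g`
with `g R = G (crossRatio x)` makes `G` a sequential crossing kernel, rigidity gives `G = F` on
`(0,1)`, and moduli of uniformizing data lie in `(0,1)`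
(`ConformalRectangle.crossRatio_mem_Ioo_of_isUniformizing`). [folklore] -/
theorem stub_conformalLimitIsCardy_of_subseqRigidity (h : CardyMirrorMonotone.SubseqRigidity) :
    ∀ u : ℕ → ℝ, Filter.Tendsto u Filter.atTop (nhdsWithin (0 : ℝ) (Set.Ioi 0)) →
      ∀ g : Literature.Probability.RandomPlanarGeometry.ConformalRectangle → ℝ,
        (∀ R : Literature.Probability.RandomPlanarGeometry.ConformalRectangle,
          Filter.Tendsto (fun n => Literature.Probability.Percolation.bondDomainCrossingProb R (u n))
            Filter.atTop (nhds (g R))) →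
        ∀ G : ℝ → ℝ,
          (∀ (R : Literature.Probability.RandomPlanarGeometry.ConformalRectangle)
            (φ : Literature.Probability.RandomPlanarGeometry.ConformalEquiv
              UpperHalfPlane.upperHalfPlaneSet R.carrier)
            (x : Fin 4 → ℝ), R.IsUniformizing φ x →
            g R = G (Literature.Probability.RandomPlanarGeometry.crossRatio x)) →
          ∀ (R : Literature.Probability.RandomPlanarGeometry.ConformalRectangle)
            (φ : Literature.Probability.RandomPlanarGeometry.ConformalEquiv
              UpperHalfPlane.upperHalfPlaneSet R.carrier)
            (x : Fin 4 → ℝ), R.IsUniformizing φ x →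
            g R = Literature.Probability.RandomPlanarGeometry.cardyFunction
              (Literature.Probability.RandomPlanarGeometry.crossRatio x) := by
  intro u hu g hg G hG R φ x hx
  have hker : ∀ (R' : ConformalRectangle) (ψ : ConformalEquiv UpperHalfPlane.upperHalfPlaneSet R'.carrier)
      (x' : Fin 4 → ℝ), R'.IsUniformizing ψ x' →
      Tendsto (fun n => bondDomainCrossingProb R' (u n)) atTop (𝓝 (G (crossRatio x'))) :=
    fun R' ψ x' hx' ↦ hG R' ψ x' hx' ▸ hg R'
  rw [hG R φ x hx]
  exact h u hu G hker (ConformalRectangle.crossRatio_mem_Ioo_of_isUniformizing hx)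

/-- **Every modulus in `(0,1)` is attained by a uniformizing datum of some conformal rectangle**:
Carleson's triangle `(Δ; 1, ζ, 0, s)` with `F(crossRatio x) = s` for `s := F η`
(`cardyFunction_crossRatio_refTriangle`) and injectivity of `F` on `[0,1]`
(`strictMonoOn_cardyFunction_holds`, `cardyFunction_zero`, `cardyFunction_one_holds`).
[folklore] -/
theorem exists_conformalRectangle_crossRatio_eq {η : ℝ} (hη : η ∈ Ioo (0 : ℝ) 1) :
    ∃ (R : ConformalRectangle) (φ : ConformalEquiv UpperHalfPlane.upperHalfPlaneSet R.carrier)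
      (x : Fin 4 → ℝ), R.IsUniformizing φ x ∧ crossRatio x = η := by
  have hmono : StrictMonoOn Literature.Probability.RandomPlanarGeometry.cardyFunction (Icc 0 1) :=
    strictMonoOn_cardyFunction_holds
  have hs : Literature.Probability.RandomPlanarGeometry.cardyFunction η ∈ Ioo (0 : ℝ) 1 := by
    have hη' : η ∈ Icc (0 : ℝ) 1 := ⟨hη.1.le, hη.2.le⟩
    constructor
    · have h := hmono (left_mem_Icc.2 zero_le_one) hη' hη.1
      rwa [cardyFunction_zero] at h
    · have h := hmono hη' (right_mem_Icc.2 zero_le_one) hη.2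
      rwa [show Literature.Probability.RandomPlanarGeometry.cardyFunction 1 = 1 from
        cardyFunction_one_holds] at h
  set R := triangleRectangle 1 equilateralApex 0 affineIndependent_refTriangle _ hs
  obtain ⟨φ, x, hφ⟩ := MarkedDomain.exists_isUniformizing_holds R
  have hval := cardyFunction_crossRatio_refTriangle hs hφ
  have hx : crossRatio x ∈ Ioo (0 : ℝ) 1 := ConformalRectangle.crossRatio_mem_Ioo_of_isUniformizing hφ
  exact ⟨R, φ, x, hφ, hmono.injOn ⟨hx.1.le, hx.2.le⟩ ⟨hη.1.le, hη.2.le⟩ hval⟩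

/-- **Sequential rigidity from S3.** Conversely, the registered stub S3 `stub_conformalLimitIsCardy`
implies the crux `CardyMirrorMonotone.SubseqRigidity` (stmt-CriticalPhenomena-8271) over proved tree
facts: uniformizing data exist (`MarkedDomain.exists_isUniformizing_holds`), so a modulus-kernel `g`
defines the rectangle-indexed joint limit `R ↦ g (crossRatio x_R)`; limits are unique; and every
`η ∈ (0,1)` is a modulus (`exists_conformalRectangle_crossRatio_eq`). So S3 is EXACTLY as hard as
stmt-8271 (and its verbatim twins stmt-4680, stmt-8850). [folklore] -/
theorem subseqRigidity_of_stub_conformalLimitIsCardy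
    (h : ∀ u : ℕ → ℝ, Filter.Tendsto u Filter.atTop (nhdsWithin (0 : ℝ) (Set.Ioi 0)) →
      ∀ g : Literature.Probability.RandomPlanarGeometry.ConformalRectangle → ℝ,
        (∀ R : Literature.Probability.RandomPlanarGeometry.ConformalRectangle,
          Filter.Tendsto (fun n => Literature.Probability.Percolation.bondDomainCrossingProb R (u n))
            Filter.atTop (nhds (g R))) →
        ∀ G : ℝ → ℝ,
          (∀ (R : Literature.Probability.RandomPlanarGeometry.ConformalRectangle)
            (φ : Literature.Probability.RandomPlanarGeometry.ConformalEquiv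
              UpperHalfPlane.upperHalfPlaneSet R.carrier)
            (x : Fin 4 → ℝ), R.IsUniformizing φ x →
            g R = G (Literature.Probability.RandomPlanarGeometry.crossRatio x)) →
          ∀ (R : Literature.Probability.RandomPlanarGeometry.ConformalRectangle)
            (φ : Literature.Probability.RandomPlanarGeometry.ConformalEquiv
              UpperHalfPlane.upperHalfPlaneSet R.carrier)
            (x : Fin 4 → ℝ), R.IsUniformizing φ x →
            g R = Literature.Probability.RandomPlanarGeometry.cardyFunction
              (Literature.Probability.RandomPlanarGeometry.crossRatio x)) :
    CardyMirrorMonotone.SubseqRigidity := by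
  intro u hu g hg η hη
  classical
  -- the rectangle-indexed joint limit: `g` at the modulus of a chosen uniformizing datum
  let gR : ConformalRectangle → ℝ := fun R ↦
    g (crossRatio (Classical.choose (Classical.choose_spec (MarkedDomain.exists_isUniformizing_holds R))))
  have hgR : ∀ R : ConformalRectangle,
      Tendsto (fun n => bondDomainCrossingProb R (u n)) atTop (𝓝 (gR R)) := fun R ↦
    hg R _ _ (Classical.choose_spec (Classical.choose_spec (MarkedDomain.exists_isUniformizing_holds R)))
  have hG : ∀ (R : ConformalRectangle) (φ : ConformalEquiv UpperHalfPlane.upperHalfPlaneSet R.carrier)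
      (x : Fin 4 → ℝ), R.IsUniformizing φ x → gR R = g (crossRatio x) :=
    fun R φ x hx ↦ tendsto_nhds_unique (hgR R) (hg R φ x hx)
  obtain ⟨R, φ, x, hx, hxη⟩ := exists_conformalRectangle_crossRatio_eq hη
  have := h u hu gR hgR g hG R φ x hx
  rw [hG R φ x hx, hxη] at this
  exact this

/-! ### The crux modulo the two existing items -/

/-- **`SubseqCardy` (stmt-CriticalPhenomena-5768) from X_M (stmt-8266) and sequential rigidity
(stmt-8271).** Run `SubseqConformalInvariance` along the meshes `1/(n+1)`: a subsequence `u` and a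
kernel `G` with `bondDomainCrossingProb R (u n) → G (crossRatio x)` for every uniformizing datum;
`SubseqRigidity` identifies `G` with Cardy's function on `(0,1)`, where all moduli of uniformizing
data lie. The crux of routes `CardyAnchoredRigidity` / `CardyLocalRigidity` is thus closed modulo
these two existing items. [folklore] -/
theorem subseqCardy_of_items : Summit.CriticalPhenomena.CardyFormulaZ2.Theses.CardyMirrorMonotone.SubseqConformalInvariance → Summit.CriticalPhenomena.CardyFormulaZ2.Theses.CardyMirrorMonotone.SubseqRigidity → Summit.CriticalPhenomena.CardyFormulaZ2.Theses.CardyAnchoredRigidity.SubseqCardy := by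
  intro hXM hRig
  have hu₀ : Tendsto (fun n : ℕ => 1 / ((n : ℝ) + 1)) atTop (𝓝[>] (0 : ℝ)) :=
    tendsto_one_div_strictMono_add_one_nhdsWithin_Ioi strictMono_id
  obtain ⟨φ, hφ, G, hG⟩ := hXM _ hu₀
  have hu : Tendsto (fun n : ℕ => 1 / (((φ n : ℕ) : ℝ) + 1)) atTop (𝓝[>] (0 : ℝ)) :=
    tendsto_one_div_strictMono_add_one_nhdsWithin_Ioi hφ
  have hEq : EqOn G Literature.Probability.RandomPlanarGeometry.cardyFunction (Ioo 0 1) :=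
    hRig _ hu G hG
  refine ⟨fun n : ℕ => 1 / (((φ n : ℕ) : ℝ) + 1), hu, fun R ψ x hx => ?_⟩
  rw [← hEq (ConformalRectangle.crossRatio_mem_Ioo_of_isUniformizing hx)]
  exact hG R ψ x hx

/-! ### Non-vacuity: joint limits are `(0,1)`-valued -/

/-- **Every joint sequential limit of bond-`ℤ²` crossing probabilities is `(0,1)`-valued** on every
conformal rectangle (RSW non-degeneracy `discreteCrossingProb_clusterPt_mem_Ioo_holds`, proved in the
tree): so the hypotheses of S2/S3 are satisfiable only by non-degenerate `g`, and a kernel `G` maps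
the moduli into `(0,1)`. [folklore] -/
theorem jointLimit_mem_Ioo {u : ℕ → ℝ} (hu : Tendsto u atTop (𝓝[>] (0 : ℝ)))
    {g : ConformalRectangle → ℝ}
    (hg : ∀ R : ConformalRectangle, Tendsto (fun n => bondDomainCrossingProb R (u n)) atTop (𝓝 (g R)))
    (R : ConformalRectangle) : g R ∈ Ioo (0 : ℝ) 1 :=
  discreteCrossingProb_clusterPt_mem_Ioo_holds R
    (MapClusterPt.of_comp (φ := u) (p := atTop) hu (hg R).mapClusterPt)

end Summit.CriticalPhenomena.CardyFormulaZ2.Cruxes.SubseqCardy.Birth
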